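import Literature.NumberTheory.Automorphic.GL2RSLFactorExistence
import Literature.NumberTheory.Automorphic.RSLFactorGL2AddCharIndependence
import Literature.NumberTheory.Automorphic.RankinSelbergLocalEquiv
import Literature.NumberTheory.Automorphic.LocalComponentBJGenericProofs
import Literature.NumberTheory.Automorphic.LocalComponentBJExistsProofs
import Literature.NumberTheory.Automorphic.LocalComponentBJUniqueProofs
import Literature.NumberTheory.Automorphic.HarishChandraFinitenessGL
import HarnessLib

/-!
# The local Euler factor `L(s, Π_u) = 1/P_u(q_u^{-s})` of a cuspidal automorphic representation of
# `GL₂(𝔸_F)` at a finite place — well-definedness (Jacquet–Langlands 1970, Thm. 2.18)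

Topic `Literature/NumberTheory/Automorphic`; proof file (theorems only: no definition, no named
fact, no instance).  For a cuspidal automorphic representation `Π` of `GL₂(𝔸_F)` (Borel–Jacquet
datum `CuspidalAutomorphicRepData 2 F hcpt`) and a finite place `u`, the LOCAL EULER POLYNOMIAL
`P_u ∈ ℂ[X]` — `L(s, Π_u) = P_u(q_u^{-s})⁻¹`, `P_u(0) = 1`, `deg P_u ≤ 2` (Jacquet–Langlands 1970,
Thm. 2.18 with Props. 3.5–3.6) — is, in the tree's language, the Jacquet–Piatetski-Shapiro–Shalika
`L`-polynomial of the pair `(Π_u, 1)` on `GL₂(F_u) × GL₁(F_u)` (`HasRSLFactor (1<2) Π_u 1 ψ ν P_u`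
of `RankinSelbergLocal`) for an irreducible smooth local component `Π_u`
(`AutomorphicRepData.HasLocalComponentAt`).  We prove that this is WELL DEFINED — independent of

* the local component (two are isomorphic, `hasLocalComponentAt_unique_holds`; `HasRSLFactor` is
  invariant under isomorphism, `hasRSLFactor_iff_of_equiv_left`),
* the non-trivial continuous additive character `ψ` (`hasRSLFactor_iff_of_isContinuousNontrivial`,
  `RSLFactorGL2AddCharIndependence`),
* the `GL₁(F_u)`-invariant Radon full-support measure `ν` on `GL₁(F_u) ⧸ U₁`
  (`hasRSLFactor_iff_of_smulInvariant`, `RSLFactorGLOneMeasureIndependence`), and of the Borel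
  structures,

and EXISTS (`existsUnique_hasRSLFactor_smoothIrrep_fin_two`, `GL2RSLFactorExistence`: the local
component exists by `exists_hasLocalComponentAt_of_isAdmissible` with
`automorphicRep_isAdmissible_holds`, and is generic for Tate's character,
`CuspidalAutomorphicRepData.isGeneric_of_hasLocalComponentAt`):

`existsUnique_localEulerPolynomial`: `∃! P, ∀ Π_u ψ ν, HasRSLFactor (1<2) Π_u 1 ψ ν P`, and this `P`
has `P(0) = 1`, `deg P ≤ 2` (`exists_localEulerPolynomial`).  This is the object `L Π u` of the
standard `L`-function theory of cuspidal `GL(2)` (`JacquetLanglands1970_standardLTheoryGL2`).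

## References

* H. Jacquet, R. P. Langlands, *Automorphic Forms on GL(2)*, LNM 114 (1970), Thm. 2.18,
  Props. 3.5, 3.6; §9 (local factors of the components of a cuspidal `π`). [JacquetLanglands1970]
* H. Jacquet, I. I. Piatetski-Shapiro, J. A. Shalika, *Rankin–Selberg convolutions*, Amer. J.
  Math. 105 (1983), Thm. 2.7 (i)–(ii). [JacquetPiatetskiShapiroShalika1983]
* D. Flath, *Decomposition of representations into tensor products*, Corvallis 1979, Thm. 3, 4.
  [FlathCorvallis1979]
-/

noncomputable section

open scoped MatrixGroups NNReal
open MeasureTheory NumberField IsDedekindDomain Polynomial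

namespace Literature.NumberTheory.Automorphic

section LocalEuler

variable {F : Type} [Field F] [NumberField F] {hcpt : isCompact_glFiniteIntegralLevel 2 F}

/-- **The local Euler polynomial of a cuspidal `Π` on `GL₂(𝔸_F)` at `u` exists and is canonical**
(Jacquet–Langlands 1970, Thm. 2.18; JPSS 1983, Thm. 2.7 (i)–(ii); Flath 1979, Thm. 3–4).  There is
`P ∈ ℂ[X]` with `P(0) = 1`, `deg P ≤ 2`, such that for EVERY irreducible smooth local component
`Π_u` of `Π` at `u`, every non-trivial continuous `ψ`, all Borel structures and every
`GL₁(F_u)`-invariant Radon full-support `ν` on `GL₁(F_u) ⧸ U₁`: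
`HasRSLFactor (1<2) Π_u 1 ψ ν P` (`L(s, Π_u) = L(s, Π_u × 1) = 1/P(q_u^{-s})`).
[cite: JacquetLanglands1970, Thm. 2.18] [cite: JacquetPiatetskiShapiroShalika1983, Thm. 2.7 (i)–(ii)] -/
theorem exists_localEulerPolynomial (π : CuspidalAutomorphicRepData 2 F hcpt)
    (u : HeightOneSpectrum (𝓞 F)) :
    ∃ P : ℂ[X], P.eval 0 = 1 ∧ P.natDegree ≤ 2 ∧
      ∀ (πu : SmoothIrrep (GL (Fin 2) (u.adicCompletion F))), π.1.HasLocalComponentAt u πu.ρ →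
      ∀ (ψ : AddChar (u.adicCompletion F) Circle), ψ.IsContinuousNontrivial →
      ∀ [MeasurableSpace (u.adicCompletion F)] [BorelSpace (u.adicCompletion F)]
        [MeasurableSpace (GL (Fin 1) (u.adicCompletion F) ⧸ upperUnitriangular (Fin 1) (u.adicCompletion F))]
        [BorelSpace (GL (Fin 1) (u.adicCompletion F) ⧸ upperUnitriangular (Fin 1) (u.adicCompletion F))]
        (ν : Measure (GL (Fin 1) (u.adicCompletion F) ⧸ upperUnitriangular (Fin 1) (u.adicCompletion F)))
        [SMulInvariantMeasure (GL (Fin 1) (u.adicCompletion F))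
          (GL (Fin 1) (u.adicCompletion F) ⧸ upperUnitriangular (Fin 1) (u.adicCompletion F)) ν]
        [IsFiniteMeasureOnCompacts ν] [ν.IsOpenPosMeasure],
        HasRSLFactor Nat.one_lt_two πu.ρ
          (Representation.trivial ℂ (GL (Fin 1) (u.adicCompletion F)) ℂ) ψ ν P := by
  classical
  -- a local component `π₀`, generic for Tate's character `ψ₀`
  obtain ⟨π₀, hloc₀⟩ := AutomorphicRepData.exists_hasLocalComponentAt_of_isAdmissible
    (automorphicRep_isAdmissible_holds hcpt) π.1 u
  haveI := π₀.isIrreducible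
  set ψ₀ : AddChar (u.adicCompletion F) Circle := (adeleAddChar F).adicComponent u with hψ₀_def
  have hψ₀ : ψ₀.IsContinuousNontrivial :=
    (isGlobalAddChar_adeleAddChar F).isContinuousNontrivial_adicComponent
      (adicComponent_adeleAddChar_ne_one u)
  have hgen₀ : IsGeneric π₀.ρ ψ₀ := π.isGeneric_of_hasLocalComponentAt u π₀.ρ π₀.isSmooth hloc₀
  -- Borel structures and an invariant measure `ν₀`
  letI mF : MeasurableSpace (u.adicCompletion F) := borel _
  haveI : BorelSpace (u.adicCompletion F) := ⟨rfl⟩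
  letI mQ : MeasurableSpace
      (GL (Fin 1) (u.adicCompletion F) ⧸ upperUnitriangular (Fin 1) (u.adicCompletion F)) := borel _
  haveI : BorelSpace
      (GL (Fin 1) (u.adicCompletion F) ⧸ upperUnitriangular (Fin 1) (u.adicCompletion F)) := ⟨rfl⟩
  obtain ⟨μ', hμ', ν₀, hinv₀, hfin₀, hpos₀, -⟩ :=
    Literature.NumberTheory.EllipticCurves.Hida2000Thm326.exists_haar_measure_quotient_fin_one
      (F := u.adicCompletion F)
  haveI := hinv₀; haveI := hfin₀; haveI := hpos₀
  obtain ⟨P, hP, -⟩ := existsUnique_hasRSLFactor_smoothIrrep_fin_two π₀ hψ₀ hgen₀ ν₀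
  -- the degree bound
  have hdeg : P.natDegree ≤ 2 := by
    obtain ⟨ν₁, hinv₁, hfin₁, hpos₁, hC⟩ := natDegree_le_two_of_hasRSLFactor π₀ hψ₀
    haveI := hinv₁; haveI := hfin₁; haveI := hpos₁
    exact hC P ((hasRSLFactor_iff_of_smulInvariant Nat.one_lt_two π₀.ρ _ ψ₀ ν₀ ν₁ P).1 hP)
  refine ⟨P, hP.1, hdeg, ?_⟩
  intro πu hloc ψ hψ mF' hBF mQ' hBQ ν hinv hfin hpos
  -- reduce the Borel structures to `borel`
  have hmF : mF' = mF := BorelSpace.measurable_eq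
  subst hmF
  have hmQ : mQ' = mQ := BorelSpace.measurable_eq
  subst hmQ
  -- the local component: `πu ≅ π₀`
  haveI := πu.isIrreducible
  obtain ⟨e⟩ := (IrrClass.mk_eq_mk_iff πu π₀).1
    (AutomorphicRepData.hasLocalComponentAt_unique_holds π.1 u πu π₀ hloc hloc₀)
  rw [hasRSLFactor_iff_of_equiv_left e P]
  -- the character and the measure
  rw [hasRSLFactor_iff_of_isContinuousNontrivial π₀.ρ hψ hψ₀ ν P,
    hasRSLFactor_iff_of_smulInvariant Nat.one_lt_two π₀.ρ _ ψ₀ ν ν₀ P]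
  exact hP

/-- **Uniqueness and existence of the local Euler polynomial** (Jacquet–Langlands 1970,
Thm. 2.18; JPSS 1983, Thm. 2.7 (ii): `L`-factors are well defined): there is EXACTLY ONE
`P ∈ ℂ[X]` which is a JPSS `L`-polynomial of `(Π_u, 1)` for every local component `Π_u`, every
`ψ`, every Borel structure and every invariant measure — the local Euler polynomial of `Π` at `u`.
[cite: JacquetLanglands1970, Thm. 2.18] [cite: JacquetPiatetskiShapiroShalika1983, Thm. 2.7 (ii)] -/
theorem existsUnique_localEulerPolynomial (π : CuspidalAutomorphicRepData 2 F hcpt)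
    (u : HeightOneSpectrum (𝓞 F)) :
    ∃! P : ℂ[X],
      ∀ (πu : SmoothIrrep (GL (Fin 2) (u.adicCompletion F))), π.1.HasLocalComponentAt u πu.ρ →
      ∀ (ψ : AddChar (u.adicCompletion F) Circle), ψ.IsContinuousNontrivial →
      ∀ [MeasurableSpace (u.adicCompletion F)] [BorelSpace (u.adicCompletion F)]
        [MeasurableSpace (GL (Fin 1) (u.adicCompletion F) ⧸ upperUnitriangular (Fin 1) (u.adicCompletion F))]
        [BorelSpace (GL (Fin 1) (u.adicCompletion F) ⧸ upperUnitriangular (Fin 1) (u.adicCompletion F))]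
        (ν : Measure (GL (Fin 1) (u.adicCompletion F) ⧸ upperUnitriangular (Fin 1) (u.adicCompletion F)))
        [SMulInvariantMeasure (GL (Fin 1) (u.adicCompletion F))
          (GL (Fin 1) (u.adicCompletion F) ⧸ upperUnitriangular (Fin 1) (u.adicCompletion F)) ν]
        [IsFiniteMeasureOnCompacts ν] [ν.IsOpenPosMeasure],
        HasRSLFactor Nat.one_lt_two πu.ρ
          (Representation.trivial ℂ (GL (Fin 1) (u.adicCompletion F)) ℂ) ψ ν P := by
  classical
  obtain ⟨P, -, -, hP⟩ := exists_localEulerPolynomial π u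
  refine ⟨P, hP, fun P' hP' => ?_⟩
  -- compare at one choice of the data
  obtain ⟨π₀, hloc₀⟩ := AutomorphicRepData.exists_hasLocalComponentAt_of_isAdmissible
    (automorphicRep_isAdmissible_holds hcpt) π.1 u
  haveI := π₀.isIrreducible
  have hψ₀ : ((adeleAddChar F).adicComponent u).IsContinuousNontrivial :=
    (isGlobalAddChar_adeleAddChar F).isContinuousNontrivial_adicComponent
      (adicComponent_adeleAddChar_ne_one u)
  have hgen₀ : IsGeneric π₀.ρ ((adeleAddChar F).adicComponent u) :=
    π.isGeneric_of_hasLocalComponentAt u π₀.ρ π₀.isSmooth hloc₀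
  letI mF : MeasurableSpace (u.adicCompletion F) := borel _
  haveI : BorelSpace (u.adicCompletion F) := ⟨rfl⟩
  letI mQ : MeasurableSpace
      (GL (Fin 1) (u.adicCompletion F) ⧸ upperUnitriangular (Fin 1) (u.adicCompletion F)) := borel _
  haveI : BorelSpace
      (GL (Fin 1) (u.adicCompletion F) ⧸ upperUnitriangular (Fin 1) (u.adicCompletion F)) := ⟨rfl⟩
  obtain ⟨μ', hμ', ν₀, hinv₀, hfin₀, hpos₀, -⟩ :=
    Literature.NumberTheory.EllipticCurves.Hida2000Thm326.exists_haar_measure_quotient_fin_one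
      (F := u.adicCompletion F)
  haveI := hinv₀; haveI := hfin₀; haveI := hpos₀
  obtain ⟨P₀, -, huniq⟩ := existsUnique_hasRSLFactor_smoothIrrep_fin_two π₀ hψ₀ hgen₀ ν₀
  rw [huniq P (hP π₀ hloc₀ _ hψ₀ ν₀), huniq P' (hP' π₀ hloc₀ _ hψ₀ ν₀)]

/-- **The local Euler polynomial has constant term `1` and degree `≤ 2`** (Jacquet–Langlands
1970, Thm. 2.18 with Props. 3.5, 3.6): every `P` which is a JPSS `L`-polynomial of `(Π_u, 1)` for
some irreducible smooth local component, some non-trivial continuous `ψ` and some invariant Radon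
full-support `ν` has `P(0) = 1` and `deg P ≤ 2`. [cite: JacquetLanglands1970, Thm. 2.18, Props. 3.5–3.6] -/
theorem eval_zero_and_natDegree_le_two_of_hasRSLFactor_localComponent
    (π : CuspidalAutomorphicRepData 2 F hcpt) (u : HeightOneSpectrum (𝓞 F))
    (πu : SmoothIrrep (GL (Fin 2) (u.adicCompletion F))) (_hloc : π.1.HasLocalComponentAt u πu.ρ)
    {ψ : AddChar (u.adicCompletion F) Circle} (hψ : ψ.IsContinuousNontrivial)
    [MeasurableSpace (u.adicCompletion F)] [BorelSpace (u.adicCompletion F)]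
    [MeasurableSpace (GL (Fin 1) (u.adicCompletion F) ⧸ upperUnitriangular (Fin 1) (u.adicCompletion F))]
    [BorelSpace (GL (Fin 1) (u.adicCompletion F) ⧸ upperUnitriangular (Fin 1) (u.adicCompletion F))]
    (ν : Measure (GL (Fin 1) (u.adicCompletion F) ⧸ upperUnitriangular (Fin 1) (u.adicCompletion F)))
    [SMulInvariantMeasure (GL (Fin 1) (u.adicCompletion F))
      (GL (Fin 1) (u.adicCompletion F) ⧸ upperUnitriangular (Fin 1) (u.adicCompletion F)) ν]
    [IsFiniteMeasureOnCompacts ν] [ν.IsOpenPosMeasure] {P : ℂ[X]}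
    (hP : HasRSLFactor Nat.one_lt_two πu.ρ
      (Representation.trivial ℂ (GL (Fin 1) (u.adicCompletion F)) ℂ) ψ ν P) :
    P.eval 0 = 1 ∧ P.natDegree ≤ 2 := by
  refine ⟨hP.1, ?_⟩
  obtain ⟨ν₁, hinv₁, hfin₁, hpos₁, hC⟩ := natDegree_le_two_of_hasRSLFactor πu hψ
  haveI := hinv₁; haveI := hfin₁; haveI := hpos₁
  exact hC P ((hasRSLFactor_iff_of_smulInvariant Nat.one_lt_two πu.ρ _ ψ ν ν₁ P).1 hP)

end LocalEuler

end Literature.NumberTheory.Automorphic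

end
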